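import Summits.ValiantsHypothesis.ValiantsHypothesis.Theorems.KPlusLogSqLawTropicalGradedWalkDomXOneGlue2

/-!
# Dominance glue for the `u = 1` excursion, part C: the block columns `3 ≤ b < w`

GRW-lite `K = 4` graded-walk family (census side of the tropical root law, all `m`):
dominance glue for the EXCURSION state `(w, 1, 1)`, `2 ≤ w ≤ m − 1` (potential `UX1` of `…PotX`); this part dispatches the rivals
of the block columns `b ≥ 3` (intended row `m − w + b`, class `1`, level `w`, bend `SX1L b`) to the generated families of
`…DomXOne4` – `…DomXOne7`.

Honest framing: census-side (lower-bound) construction; nothing here bears on `TropicalB` inside its window or on VP ≠ VNP.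
-/

set_option linter.dupNamespace false
set_option autoImplicit false

namespace Summit.ValiantsHypothesis.ValiantsHypothesis.Theorems.LacunarySymmetroidMatrixDescartes.TropicalCensus

namespace GradedWalk

open Summit.ValiantsHypothesis.ValiantsHypothesis.Theorems.MatrixDescartes.Negative

variable (n : ℕ)

/-! ### slack, columns `3 ≤ b < w` -/

set_option maxHeartbeats 400000 in
/-- slack of the type-X certificate for `u = 1`: block columns `b ≥ 3`, upper and diagonal rivals. -/
theorem slackX1_ge_hi (w : ℕ) (hw2 : 2 ≤ w) (hwn : w ≤ n) (a b : Fin (n + 1)) (l : Fin 4)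
    (hp : ee n a b l ≠ 0) (hb3 : 3 ≤ (b : ℕ)) (hbw : (b : ℕ) < w) (hab : (a : ℕ) ≤ (b : ℕ)) :
    1 * (thX n w 1 * (dd n l : ℤ) - vv n a b l) <
      UX1 n w a + ((thX n w 1 * (dd n (lam n w 1 1 b) : ℤ) - vv n (perm n w 1 1 b) b (lam n w 1 1 b)) - UX1 n w (perm n w 1 1 b)) := by
  have hw1 : w ≤ n + 1 := by omega
  have huw : 1 < w := by omega
  have hb1w : (b : ℕ) + 1 ≤ w := by omega
  have hr : ((perm n w 1 1 b : Fin (n + 1)) : ℕ) = (b : ℕ) + (n + 1 - w) := sigmaX_blk n huw hw1 b hbw (by omega) (by omega)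
  rw [lam_X1 n huw, if_neg (by omega), if_neg (by omega)]
  have hlowr : (b : ℕ) < ((perm n w 1 1 b : Fin (n + 1)) : ℕ) := by rw [hr]; omega
  have hT1 : thX n w 1 * (dd n 1 : ℤ) - vv n (perm n w 1 1 b) b 1 = thX n w 1 * d1 n - v1 n (w) ((b : ℕ)) := by
    rw [dd_cast_one, vv_lower n hlowr, hr, show n + 1 + (b : ℕ) - ((b : ℕ) + (n + 1 - w)) = w by omega, vblk_one]
  have hUr : UX1 n w ((perm n w 1 1 b : Fin (n + 1)) : ℕ) = gG n * thX n w 1 * (((n + 1 - w + ((b : ℕ))) : ℕ) : ℤ) + SX1L n w ((b : ℕ)) :=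
    UX1_RL n (b : ℕ) hwn hb3 (by rw [hr]; omega)
  clear hlowr
  rcases Nat.lt_or_eq_of_le hab with hab' | habe
  · -- upper cells
    have hl : l = 0 ∨ l = 1 := by
      rcases (show l = 0 ∨ l = 1 ∨ l = 2 ∨ l = 3 by fin_cases l <;> simp) with rfl | rfl | rfl | rfl
      · exact Or.inl rfl
      · exact Or.inr rfl
      · exact absurd (ee_upper_ge_two n hab' 2 (by decide)) hp
      · exact absurd (ee_upper_ge_two n hab' 3 (by decide)) hp
    rcases Nat.lt_or_ge (a : ℕ) (n + 1 - w) with hpre | hblk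
    · -- pre-block rows
      have hYa : UX1 n w a - UX1 n w ((perm n w 1 1 b : Fin (n + 1)) : ℕ) =
          (gG n * thX n w 1 * ((((a : ℕ)) : ℕ) : ℤ) - (gG n * thX n w 1 * (((n + 1 - w + ((b : ℕ))) : ℕ) : ℤ) + SX1L n w ((b : ℕ)))) := by
        rw [hUr, UX1_pre n (show (a : ℕ) ≤ n - w by omega)]
      rcases Nat.eq_zero_or_pos (a : ℕ) with ha0 | ha1
      · have hY : UX1 n w a - UX1 n w ((perm n w 1 1 b : Fin (n + 1)) : ℕ) =
            ((0 : ℤ) - (gG n * thX n w 1 * (((n + 1 - w + ((b : ℕ))) : ℕ) : ℤ) + SX1L n w ((b : ℕ)))) := by rw [hYa, ha0]; simp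
        rcases hl with rfl | rfl
        · exact slack_of (X1_ge_w0_R0 n w b hb3 hb1w hwn) (by rw [X1up0_of n hab' (b : ℕ) (by omega)]) hT1 hY
        · exact slack_of (X1_ge_cn_R0 n w b hb3 hb1w hwn) (by rw [X1up1_of n hab' (b : ℕ) (by omega)]) hT1 hY
      · rcases Nat.lt_or_ge (a : ℕ) 3 with ha3 | ha3
        · rcases Nat.lt_or_ge (a : ℕ) 2 with ha2 | ha2
          · have hY : UX1 n w a - UX1 n w ((perm n w 1 1 b : Fin (n + 1)) : ℕ) =
                (gG n * thX n w 1 * (((1) : ℕ) : ℤ) - (gG n * thX n w 1 * (((n + 1 - w + ((b : ℕ))) : ℕ) : ℤ) + SX1L n w ((b : ℕ)))) := by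
              rw [hYa, show (a : ℕ) = 1 by omega]
            rcases hl with rfl | rfl
            · exact slack_of (X1_ge_w0_P1 n w b hb3 hb1w (by omega)) (by rw [X1up0_of n hab' ((b : ℕ) - 1) (by omega)]) hT1 hY
            · exact slack_of (X1_ge_cn_P1 n w b hb3 hb1w (by omega)) (by rw [X1up1_of n hab' ((b : ℕ) - 1) (by omega)]) hT1 hY
          · have hY : UX1 n w a - UX1 n w ((perm n w 1 1 b : Fin (n + 1)) : ℕ) =
                (gG n * thX n w 1 * (((2) : ℕ) : ℤ) - (gG n * thX n w 1 * (((n + 1 - w + ((b : ℕ))) : ℕ) : ℤ) + SX1L n w ((b : ℕ)))) := by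
              rw [hYa, show (a : ℕ) = 2 by omega]
            rcases hl with rfl | rfl
            · exact slack_of (X1_ge_w0_P2 n w b hb3 hb1w (by omega)) (by rw [X1up0_of n hab' ((b : ℕ) - 2) (by omega)]) hT1 hY
            · exact slack_of (X1_ge_cn_P2 n w b hb3 hb1w (by omega)) (by rw [X1up1_of n hab' ((b : ℕ) - 2) (by omega)]) hT1 hY
        · rcases hl with rfl | rfl
          · exact slack_of (X1_ge_w0_Pa n w b a ha3 (by omega) hb1w (by omega)) (by rw [X1up0_of n hab' ((b : ℕ) - (a : ℕ)) (by omega)]) hT1 hYa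
          · exact slack_of (X1_ge_cn_Pa n w b a ha3 (by omega) hb1w (by omega)) (by rw [X1up1_of n hab' ((b : ℕ) - (a : ℕ)) (by omega)]) hT1 hYa
    · -- block rows above the diagonal
      obtain ⟨j, hj⟩ : ∃ j, (a : ℕ) = (n + 1 - w) + j := ⟨(a : ℕ) - (n + 1 - w), by omega⟩
      rcases Nat.lt_or_ge j 3 with hj3 | hj3
      · rcases Nat.lt_or_ge j 1 with hj1 | hj1
        · -- `j = 0`: the junction row
          have hY : UX1 n w a - UX1 n w ((perm n w 1 1 b : Fin (n + 1)) : ℕ) =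
              ((gG n * thX n w 1 * (((n + 1 - w + (0)) : ℕ) : ℤ) + SX1R1 n w) - (gG n * thX n w 1 * (((n + 1 - w + ((b : ℕ))) : ℕ) : ℤ) + SX1L n w ((b : ℕ)))) := by
            rw [hUr, UX1_R1 n hwn (by omega)]
          rcases Nat.lt_or_ge w n with hwn' | hwn'
          · rcases hl with rfl | rfl
            · exact slack_of (X1_ge_w0_R1b n w b (n + 1 - w) (by omega) (by omega) hb1w (by omega)) (by rw [X1up0_of n hab' ((b : ℕ) - (n + 1 - w)) (by omega)]) hT1 hY
            · exact slack_of (X1_ge_cn_R1b n w b (n + 1 - w) (by omega) (by omega) hb1w (by omega)) (by rw [X1up1_of n hab' ((b : ℕ) - (n + 1 - w)) (by omega)]) hT1 hY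
          · rcases hl with rfl | rfl
            · exact slack_of (X1_ge_w0_R1a n w b hb3 hb1w (by omega)) (by rw [X1up0_of n hab' ((b : ℕ) - 1) (by omega)]) hT1 hY
            · exact slack_of (X1_ge_cn_R1a n w b hb3 hb1w (by omega)) (by rw [X1up1_of n hab' ((b : ℕ) - 1) (by omega)]) hT1 hY
        · rcases Nat.lt_or_ge j 2 with hj2 | hj2
          · have hY : UX1 n w a - UX1 n w ((perm n w 1 1 b : Fin (n + 1)) : ℕ) =
                ((gG n * thX n w 1 * (((n + 1 - w + (1)) : ℕ) : ℤ) + SX1R2 n w) - (gG n * thX n w 1 * (((n + 1 - w + ((b : ℕ))) : ℕ) : ℤ) + SX1L n w ((b : ℕ)))) := by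
              rw [hUr, UX1_R2 n hwn (by omega)]
            rcases hl with rfl | rfl
            · exact slack_of (X1_ge_w0_R2 n w b (n + 1 - w) (by omega) (by omega) hb1w (by omega)) (by rw [X1up0_of n hab' ((b : ℕ) - ((n + 1 - w) + 1)) (by omega)]) hT1 hY
            · exact slack_of (X1_ge_cn_R2 n w b (n + 1 - w) (by omega) (by omega) hb1w (by omega)) (by rw [X1up1_of n hab' ((b : ℕ) - ((n + 1 - w) + 1)) (by omega)]) hT1 hY
          · have hY : UX1 n w a - UX1 n w ((perm n w 1 1 b : Fin (n + 1)) : ℕ) =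
                ((gG n * thX n w 1 * (((n + 1 - w + (2)) : ℕ) : ℤ) + SX1P n) - (gG n * thX n w 1 * (((n + 1 - w + ((b : ℕ))) : ℕ) : ℤ) + SX1L n w ((b : ℕ)))) := by
              rw [hUr, UX1_RP n hwn (by omega)]
            rcases hl with rfl | rfl
            · exact slack_of (X1_ge_w0_RP n w b (n + 1 - w) (by omega) (by omega) hb1w (by omega)) (by rw [X1up0_of n hab' ((b : ℕ) - ((n + 1 - w) + 2)) (by omega)]) hT1 hY
            · exact slack_of (X1_ge_cn_RP n w b (n + 1 - w) (by omega) (by omega) hb1w (by omega)) (by rw [X1up1_of n hab' ((b : ℕ) - ((n + 1 - w) + 2)) (by omega)]) hT1 hY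
      · have hY : UX1 n w a - UX1 n w ((perm n w 1 1 b : Fin (n + 1)) : ℕ) =
            ((gG n * thX n w 1 * (((n + 1 - w + (j)) : ℕ) : ℤ) + SX1L n w (j)) - (gG n * thX n w 1 * (((n + 1 - w + ((b : ℕ))) : ℕ) : ℤ) + SX1L n w ((b : ℕ)))) := by
          rw [hUr, UX1_RL n j hwn hj3 hj]
        rcases hl with rfl | rfl
        · exact slack_of (X1_ge_w0_RL n w b j (n + 1 - w) (by omega) hj3 (by omega) hb1w (by omega)) (by rw [X1up0_of n hab' ((b : ℕ) - ((n + 1 - w) + j)) (by omega)]) hT1 hY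
        · exact slack_of (X1_ge_cn_RL n w b j (n + 1 - w) (by omega) hj3 (by omega) hb1w (by omega)) (by rw [X1up1_of n hab' ((b : ℕ) - ((n + 1 - w) + j)) (by omega)]) hT1 hY
  · -- the diagonal cell `(b, b)`
    have hab2 : (a : ℕ) = (b : ℕ) := habe
    have hX0 : thX n w 1 * (dd n 0 : ℤ) - vv n a b 0 = thX n w 1 * 0 - 0 := by rw [dd_cast_zero, vv_diag_zero n hab2]
    have hXl : l ≠ 0 → thX n w 1 * (dd n l : ℤ) - vv n a b l ≤ thX n w 1 * d1 n - v1 n (n + 1) ((b : ℕ)) := fun hl =>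
      X1lift_fut n huw hwn l hl hp (by omega) (n + 1) (by omega) (by omega)
    rcases Nat.lt_or_ge (b : ℕ) (n + 1 - w) with hpre | hblk
    · have hY : UX1 n w a - UX1 n w ((perm n w 1 1 b : Fin (n + 1)) : ℕ) =
          (gG n * thX n w 1 * ((((b : ℕ)) : ℕ) : ℤ) - (gG n * thX n w 1 * (((n + 1 - w + ((b : ℕ))) : ℕ) : ℤ) + SX1L n w ((b : ℕ)))) := by
        rw [hUr, UX1_pre n (show (a : ℕ) ≤ n - w by omega), hab2]
      by_cases hcl : l = 0
      · subst hcl; exact slack_of (X1_ge_dg0_P n w b hb3 hb1w (by omega)) hX0 hT1 hY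
      · exact slack_le (X1_ge_dgm_P n w b hb3 hb1w (by omega)) (hXl hcl) hT1 hY
    · obtain ⟨j, hj⟩ : ∃ j, (b : ℕ) = (n + 1 - w) + j := ⟨(b : ℕ) - (n + 1 - w), by omega⟩
      rcases Nat.lt_or_ge j 3 with hj3 | hj3
      · rcases Nat.lt_or_ge j 1 with hj1 | hj1
        · have hY : UX1 n w a - UX1 n w ((perm n w 1 1 b : Fin (n + 1)) : ℕ) =
              ((gG n * thX n w 1 * (((n + 1 - w + (0)) : ℕ) : ℤ) + SX1R1 n w) - (gG n * thX n w 1 * (((n + 1 - w + ((b : ℕ))) : ℕ) : ℤ) + SX1L n w ((b : ℕ)))) := by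
            rw [hUr, UX1_R1 n hwn (by omega)]
          by_cases hcl : l = 0
          · subst hcl; exact slack_of (X1_ge_dg0_R1 n w b hb3 hb1w (by omega)) hX0 hT1 hY
          · exact slack_le (X1_ge_dgm_R1 n w b hb3 hb1w (by omega)) (hXl hcl) hT1 hY
        · rcases Nat.lt_or_ge j 2 with hj2 | hj2
          · have hY : UX1 n w a - UX1 n w ((perm n w 1 1 b : Fin (n + 1)) : ℕ) =
                ((gG n * thX n w 1 * (((n + 1 - w + (1)) : ℕ) : ℤ) + SX1R2 n w) - (gG n * thX n w 1 * (((n + 1 - w + ((b : ℕ))) : ℕ) : ℤ) + SX1L n w ((b : ℕ)))) := by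
              rw [hUr, UX1_R2 n hwn (by omega)]
            by_cases hcl : l = 0
            · subst hcl; exact slack_of (X1_ge_dg0_R2 n w b hb3 hb1w (by omega)) hX0 hT1 hY
            · exact slack_le (X1_ge_dgm_R2 n w b hb3 hb1w (by omega)) (hXl hcl) hT1 hY
          · have hY : UX1 n w a - UX1 n w ((perm n w 1 1 b : Fin (n + 1)) : ℕ) =
                ((gG n * thX n w 1 * (((n + 1 - w + (2)) : ℕ) : ℤ) + SX1P n) - (gG n * thX n w 1 * (((n + 1 - w + ((b : ℕ))) : ℕ) : ℤ) + SX1L n w ((b : ℕ)))) := by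
              rw [hUr, UX1_RP n hwn (by omega)]
            by_cases hcl : l = 0
            · subst hcl; exact slack_of (X1_ge_dg0_RP n w b hb3 hb1w (by omega)) hX0 hT1 hY
            · exact slack_le (X1_ge_dgm_RP n w b hb3 hb1w (by omega)) (hXl hcl) hT1 hY
      · have hY : UX1 n w a - UX1 n w ((perm n w 1 1 b : Fin (n + 1)) : ℕ) =
            ((gG n * thX n w 1 * (((n + 1 - w + (j)) : ℕ) : ℤ) + SX1L n w (j)) - (gG n * thX n w 1 * (((n + 1 - w + ((b : ℕ))) : ℕ) : ℤ) + SX1L n w ((b : ℕ)))) := by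
          rw [hUr, UX1_RL n j hwn hj3 (by omega)]
        by_cases hcl : l = 0
        · subst hcl; exact slack_of (X1_ge_dg0_RL n w b j hj3 (by omega) hb1w (by omega)) hX0 hT1 hY
        · exact slack_le (X1_ge_dgm_RL n w b j hj3 (by omega) hb1w (by omega)) (hXl hcl) hT1 hY

set_option maxHeartbeats 400000 in
/-- slack of the type-X certificate for `u = 1`: block columns `b ≥ 3`, lower rivals. -/
theorem slackX1_ge_lo (w : ℕ) (hw2 : 2 ≤ w) (hwn : w ≤ n) (a b : Fin (n + 1)) (l : Fin 4)
    (hp : ee n a b l ≠ 0) (hne : perm n w 1 1 b ≠ a ∨ lam n w 1 1 b ≠ l) (hb3 : 3 ≤ (b : ℕ)) (hbw : (b : ℕ) < w)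
    (hlow : (b : ℕ) < (a : ℕ)) :
    1 * (thX n w 1 * (dd n l : ℤ) - vv n a b l) <
      UX1 n w a + ((thX n w 1 * (dd n (lam n w 1 1 b) : ℤ) - vv n (perm n w 1 1 b) b (lam n w 1 1 b)) - UX1 n w (perm n w 1 1 b)) := by
  have hw1 : w ≤ n + 1 := by omega
  have huw : 1 < w := by omega
  have hb1w : (b : ℕ) + 1 ≤ w := by omega
  have han : (a : ℕ) ≤ n := Nat.lt_succ_iff.mp a.isLt
  have hr : ((perm n w 1 1 b : Fin (n + 1)) : ℕ) = (b : ℕ) + (n + 1 - w) := sigmaX_blk n huw hw1 b hbw (by omega) (by omega)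
  rw [lam_X1 n huw, if_neg (by omega), if_neg (by omega)] at hne ⊢
  have hlowr : (b : ℕ) < ((perm n w 1 1 b : Fin (n + 1)) : ℕ) := by rw [hr]; omega
  have hwne : w ≠ n + 1 := by omega
  have hT1 : thX n w 1 * (dd n 1 : ℤ) - vv n (perm n w 1 1 b) b 1 = thX n w 1 * d1 n - v1 n (w) ((b : ℕ)) := by
    rw [dd_cast_one, vv_lower n hlowr, hr, show n + 1 + (b : ℕ) - ((b : ℕ) + (n + 1 - w)) = w by omega, vblk_one]
  have hUr : UX1 n w ((perm n w 1 1 b : Fin (n + 1)) : ℕ) = gG n * thX n w 1 * (((n + 1 - w + ((b : ℕ))) : ℕ) : ℤ) + SX1L n w ((b : ℕ)) :=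
    UX1_RL n (b : ℕ) hwn hb3 (by rw [hr]; omega)
  clear hlowr
  have hcl : l ≠ 0 := fun h0 => by subst h0; exact hp (ee_lower_zero n hlow)
  rcases Nat.lt_or_ge (a : ℕ) ((b : ℕ) + (n + 1 - w)) with hup | hge
  · -- between the diagonal and the intended row: future levels, class 1 best
    obtain ⟨E, hE⟩ : ∃ E, n + 1 + (b : ℕ) - (a : ℕ) = E := ⟨_, rfl⟩
    have hE1 : w + 1 ≤ E := by omega
    have hXl := X1lift_fut n huw hwn l hcl hp (le_of_lt hlow) E hE hE1
    rcases Nat.lt_or_ge (a : ℕ) (n + 1 - w) with hpre | hblk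
    · have hY : UX1 n w a - UX1 n w ((perm n w 1 1 b : Fin (n + 1)) : ℕ) =
          (gG n * thX n w 1 * (((n + 1 + (b : ℕ) - E) : ℕ) : ℤ) - (gG n * thX n w 1 * (((n + 1 - w + ((b : ℕ))) : ℕ) : ℤ) + SX1L n w ((b : ℕ)))) := by
        rw [hUr, UX1_pre n (show (a : ℕ) ≤ n - w by omega), show (a : ℕ) = n + 1 + (b : ℕ) - E by omega]
      exact slack_le (X1_ge_lo_P n w b E hb3 hb1w (by omega) (by omega)) hXl hT1 hY
    · obtain ⟨j, hj⟩ : ∃ j, (a : ℕ) = (n + 1 - w) + j := ⟨(a : ℕ) - (n + 1 - w), by omega⟩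
      rcases Nat.lt_or_ge j 3 with hj3 | hj3
      · rcases Nat.lt_or_ge j 1 with hj1 | hj1
        · have hEq : E = w + (b : ℕ) := by omega
          subst hEq
          have hY : UX1 n w a - UX1 n w ((perm n w 1 1 b : Fin (n + 1)) : ℕ) =
              ((gG n * thX n w 1 * (((n + 1 - w + (0)) : ℕ) : ℤ) + SX1R1 n w) - (gG n * thX n w 1 * (((n + 1 - w + ((b : ℕ))) : ℕ) : ℤ) + SX1L n w ((b : ℕ)))) := by
            rw [hUr, UX1_R1 n hwn (by omega)]
          exact slack_le (X1_ge_lo_R1 n w b hb3 hb1w (by omega)) hXl hT1 hY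
        · rcases Nat.lt_or_ge j 2 with hj2 | hj2
          · have hEq : E = w + (b : ℕ) - 1 := by omega
            subst hEq
            have hY : UX1 n w a - UX1 n w ((perm n w 1 1 b : Fin (n + 1)) : ℕ) =
                ((gG n * thX n w 1 * (((n + 1 - w + (1)) : ℕ) : ℤ) + SX1R2 n w) - (gG n * thX n w 1 * (((n + 1 - w + ((b : ℕ))) : ℕ) : ℤ) + SX1L n w ((b : ℕ)))) := by
              rw [hUr, UX1_R2 n hwn (by omega)]
            exact slack_le (X1_ge_lo_R2 n w b hb3 hb1w (by omega)) hXl hT1 hY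
          · have hEq : E = w + (b : ℕ) - 2 := by omega
            subst hEq
            have hY : UX1 n w a - UX1 n w ((perm n w 1 1 b : Fin (n + 1)) : ℕ) =
                ((gG n * thX n w 1 * (((n + 1 - w + (2)) : ℕ) : ℤ) + SX1P n) - (gG n * thX n w 1 * (((n + 1 - w + ((b : ℕ))) : ℕ) : ℤ) + SX1L n w ((b : ℕ)))) := by
              rw [hUr, UX1_RP n hwn (by omega)]
            exact slack_le (X1_ge_lo_RP n w b hb3 hb1w (by omega)) hXl hT1 hY
      · have hEq : E = w + (b : ℕ) - j := by omega
        subst hEq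
        have hY : UX1 n w a - UX1 n w ((perm n w 1 1 b : Fin (n + 1)) : ℕ) =
            ((gG n * thX n w 1 * (((n + 1 - w + (j)) : ℕ) : ℤ) + SX1L n w (j)) - (gG n * thX n w 1 * (((n + 1 - w + ((b : ℕ))) : ℕ) : ℤ) + SX1L n w ((b : ℕ)))) := by
          rw [hUr, UX1_RL n j hwn hj3 hj]
        exact slack_le (X1_ge_lo_RL n w b j hj3 (by omega) hb1w (by omega)) hXl hT1 hY
  rcases Nat.eq_or_lt_of_le hge with haeq | hagt
  · -- class rivals at the intended cell
    have hrot : perm n w 1 1 b = a := Fin.ext (by rw [hr]; omega)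
    have hY : UX1 n w a - UX1 n w ((perm n w 1 1 b : Fin (n + 1)) : ℕ) = 0 := by rw [hrot]; ring
    have hEa : n + 1 + (b : ℕ) - (a : ℕ) = w := by omega
    rcases (show l = 0 ∨ l = 1 ∨ l = 2 ∨ l = 3 by fin_cases l <;> simp) with rfl | rfl | rfl | rfl
    · exact absurd rfl hcl
    · exact absurd rfl (hne.resolve_left (fun h => h hrot))
    · have hX : thX n w 1 * (dd n 2 : ℤ) - vv n a b 2 = thX n w 1 * d2 n - (v1 n (w) ((b : ℕ)) + bB n * tau2lt n (w) ((b : ℕ))) := by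
        rw [dd_cast_two, vv_lower n hlow, hEa, vblk_two, tau2_of_ne n hwne]
      exact slack_of0 (X1_ge_cls_l2 n w b hb3 hb1w hwn) hX hT1 hY
    · have hX : thX n w 1 * (dd n 3 : ℤ) - vv n a b 3 = thX n w 1 * d3 n - ((v1 n (w) ((b : ℕ)) + bB n * tau2lt n (w) ((b : ℕ))) + tau3lt n (w) ((b : ℕ))) := by
        rw [dd_cast_three, vv_lower n hlow, hEa, vblk_three, tau2_of_ne n hwne, tau3_of_ne n hwne]
      exact slack_of0 (X1_ge_cls_l3 n w b hb3 hb1w hwn) hX hT1 hY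
  · -- below the intended cell
    obtain ⟨k, hk⟩ : ∃ k, (a : ℕ) = ((b : ℕ) + (n + 1 - w)) + k := ⟨(a : ℕ) - ((b : ℕ) + (n + 1 - w)), by omega⟩
    have hk1 : 1 ≤ k := by clear hT1 hUr hr; omega
    have hkw : (b : ℕ) + k + 1 ≤ w := by clear hT1 hUr hr; omega
    have hEa : n + 1 + (b : ℕ) - (a : ℕ) = w - k := by clear hT1 hUr hr; omega
    have hlift := X1lift_past n (w := w) l hp hlow (w - k) hEa (by clear hT1 hUr hr hEa; omega) (by clear hT1 hUr hr hEa; omega)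
    have hY : UX1 n w a - UX1 n w ((perm n w 1 1 b : Fin (n + 1)) : ℕ) =
        ((gG n * thX n w 1 * (((n + 1 - w + ((b : ℕ) + k)) : ℕ) : ℤ) + SX1L n w ((b : ℕ) + k)) - (gG n * thX n w 1 * (((n + 1 - w + ((b : ℕ))) : ℕ) : ℤ) + SX1L n w ((b : ℕ)))) := by
      rw [hUr, UX1_RL n ((b : ℕ) + k) hwn (by omega) (by clear hT1 hUr hr hEa hlift; omega)]
    have hF := X1_ge_down n w b k hk1 hb3 hkw hwn
    exact slack_of (lift_combine hlift hF) rfl hT1 hY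

end GradedWalk

end Summit.ValiantsHypothesis.ValiantsHypothesis.Theorems.LacunarySymmetroidMatrixDescartes.TropicalCensus
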